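import Summits.ValiantsHypothesis.ValiantsHypothesis.Theorems.BarrierLeverChowBenchmarkPairsSunflower

/-!
# Route BarrierLever — item 22038 `ChowBenchmarkPairs`, line `moore-peel`: the AXIS-PARALLELOGRAM NO-GO for segment-moment matrices

Helper file (`--supports stmt-ValiantsHypothesis-22038`; cell valiant-natproofs, rung V4, 𝒟-side benchmark of record; seat val-np-p4 gen 25).
Closes NO item.

**THE RELATION.**  If two points `a', b'` are obtained from two other points `a, b` by moving each along the SAME coordinate axis `c`
(`P a'` agrees with `P a` off `c`, `P b'` agrees with `P b` off `c`; the values at `c` are arbitrary), then for EVERY column `T` the four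
pair rows satisfy the exact linear relation
`segE P {a,b} T − segE P {a',b} T − segE P {a,b'} T + segE P {a',b'} T = 0` (`segE_parallelogram`):
for `c ∉ T` the four entries coincide (a segment entry only reads the coordinates in `T`), for `T = A ∪ {c}` each entry is affine in the
`c`-th coordinates of its two points with coefficients `sfCoefA/B` that do not read coordinate `c` (`segE_pair_insert` of `…Sunflower`),
and the mixed second difference of an affine function vanishes.  (Functional form: along a segment a multilinear `f` is affine in `z_c`, so
the mixed difference in the two endpoints is `λμ·s(1−s)·∂_c²f = 0`.)

**THE NO-GO** (`det_eq_zero_of_parallelogram`): consequently the segment-moment matrix of ANY column family on the rows «all subsets of size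
≤ 2» is SINGULAR for every table containing such an axis-parallelogram `a, a', b, b'` (four distinct points).  This generalises the 0/1 no-go
`det_zoTable_eq_zero_of_parallel_edges` (p629307, val-np-p4 g19: two support edges in one direction) from 0/1 designs to arbitrary tables, and
it is the design rule behind two findings of the g25 memo (HOME/val-np-p4/g25/MEMO-valnp4-g25.md §3.1, §3.6): a single «twin» `P_h = P_1 + e_c`
keeps the benchmark matrix nonsingular (numerically, every `h ≤ 36`), two twins in the same direction never do.

WHAT THIS IS NOT: a constraint on designs, not a statement about generic tables; no stub of the line is closed or refuted; nothing on crux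
stmt-ValiantsHypothesis-14610 or on `VP` versus `VNP`.
-/

set_option linter.dupNamespace false
set_option autoImplicit false

namespace Summit.ValiantsHypothesis.ValiantsHypothesis.Theorems.BarrierLever.ChowBenchmarkPeel

open Finset

variable {κ : Type*} [DecidableEq κ]

/-! ## 1. The parallelogram relation -/

section Relation

variable {F : Type*} [CommRing F] {n : ℕ}

/-- `sfCoefA` only reads the coordinates in `A`. -/
theorem sfCoefA_congr (P : Fin n → κ → F) {a a' b b' : Fin n} (A : Finset κ)
    (ha : ∀ c' ∈ A, P a' c' = P a c') (hb : ∀ c' ∈ A, P b' c' = P b c') :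
    sfCoefA P a' b' A = sfCoefA P a b A := by
  unfold sfCoefA
  refine Finset.sum_congr rfl fun d hd => ?_
  have hdA : d ⊆ A := Finset.mem_powerset.mp hd
  rw [Finset.prod_congr rfl fun c' hc' => ha c' (hdA hc'),
    Finset.prod_congr rfl fun c' hc' => hb c' (Finset.mem_sdiff.mp hc').1]

/-- `sfCoefB` only reads the coordinates in `A`. -/
theorem sfCoefB_congr (P : Fin n → κ → F) {a a' b b' : Fin n} (A : Finset κ)
    (ha : ∀ c' ∈ A, P a' c' = P a c') (hb : ∀ c' ∈ A, P b' c' = P b c') :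
    sfCoefB P a' b' A = sfCoefB P a b A := by
  unfold sfCoefB
  refine Finset.sum_congr rfl fun d hd => ?_
  have hdA : d ⊆ A := Finset.mem_powerset.mp hd
  rw [Finset.prod_congr rfl fun c' hc' => ha c' (hdA hc'),
    Finset.prod_congr rfl fun c' hc' => hb c' (Finset.mem_sdiff.mp hc').1]

/-- A pair entry only reads the coordinates in its column. -/
theorem segE_pair_congr (P : Fin n → κ → F) {a a' b b' : Fin n} (hab : a ≠ b) (hab' : a' ≠ b') (T : Finset κ)
    (ha : ∀ c' ∈ T, P a' c' = P a c') (hb : ∀ c' ∈ T, P b' c' = P b c') :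
    segE P {a', b'} T = segE P {a, b} T := by
  rw [segE_pair P a' b' hab' T, segE_pair P a b hab T]
  refine Finset.sum_congr rfl fun d hd => ?_
  have hdT : d ⊆ T := Finset.mem_powerset.mp hd
  rw [Finset.prod_congr rfl fun c' hc' => ha c' (hdT hc'),
    Finset.prod_congr rfl fun c' hc' => hb c' (Finset.mem_sdiff.mp hc').1]

/-- **THE AXIS-PARALLELOGRAM RELATION.**  If `P a'` agrees with `P a` off the coordinate `c` and `P b'` agrees with `P b` off `c`
(`a ≠ b`, `a' ≠ b`, `a ≠ b'`, `a' ≠ b'`), then for every column `T`: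
`segE P {a,b} T − segE P {a',b} T − segE P {a,b'} T + segE P {a',b'} T = 0`. -/
theorem segE_parallelogram (P : Fin n → κ → F) (c : κ) {a a' b b' : Fin n}
    (hab : a ≠ b) (ha'b : a' ≠ b) (hab' : a ≠ b') (ha'b' : a' ≠ b')
    (ha : ∀ c', c' ≠ c → P a' c' = P a c') (hb : ∀ c', c' ≠ c → P b' c' = P b c') (T : Finset κ) :
    segE P {a, b} T - segE P {a', b} T - segE P {a, b'} T + segE P {a', b'} T = 0 := by
  by_cases hcT : c ∈ T
  · -- `T = A ∪ {c}`: each entry is affine in the `c`-th coordinates with the same coefficients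
    set A := T.erase c with hA
    have hcA : c ∉ A := Finset.notMem_erase c T
    have hT : T = insert c A := (Finset.insert_erase hcT).symm
    have haA : ∀ c' ∈ A, P a' c' = P a c' := fun c' hc' => ha c' (Finset.ne_of_mem_erase hc')
    have hbA : ∀ c' ∈ A, P b' c' = P b c' := fun c' hc' => hb c' (Finset.ne_of_mem_erase hc')
    have hAA : ∀ c' ∈ A, P a c' = P a c' := fun _ _ => rfl
    have hBB : ∀ c' ∈ A, P b c' = P b c' := fun _ _ => rfl
    rw [hT, segE_pair_insert P a b hab A c hcA, segE_pair_insert P a' b ha'b A c hcA, segE_pair_insert P a b' hab' A c hcA,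
      segE_pair_insert P a' b' ha'b' A c hcA, sfCoefA_congr P A haA hBB, sfCoefB_congr P A haA hBB,
      sfCoefA_congr P A hAA hbA, sfCoefB_congr P A hAA hbA, sfCoefA_congr P A haA hbA, sfCoefB_congr P A haA hbA]
    ring
  · -- `c ∉ T`: the four entries coincide
    have haT : ∀ c' ∈ T, P a' c' = P a c' := fun c' hc' => ha c' (fun e => hcT (e ▸ hc'))
    have hbT : ∀ c' ∈ T, P b' c' = P b c' := fun c' hc' => hb c' (fun e => hcT (e ▸ hc'))
    have hAA : ∀ c' ∈ T, P a c' = P a c' := fun _ _ => rfl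
    have hBB : ∀ c' ∈ T, P b c' = P b c' := fun _ _ => rfl
    rw [segE_pair_congr P hab ha'b T haT hBB, segE_pair_congr P hab hab' T hAA hbT, segE_pair_congr P hab ha'b' T haT hbT]
    ring

end Relation

/-! ## 2. The no-go -/

section NoGo

variable {F : Type*} [Field F] {n : ℕ}

/-- **AXIS-PARALLELOGRAM NO-GO.**  If the table contains four distinct points `a, a', b, b'` with `P a'` agreeing with `P a` off one
coordinate `c` and `P b'` agreeing with `P b` off the same `c`, then the segment-moment matrix «all rows of size ≤ 2 × any column family»
is singular. -/
theorem det_eq_zero_of_parallelogram (P : Fin n → κ → F) (col : Row n → Finset κ) (c : κ) {a a' b b' : Fin n}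
    (haa' : a ≠ a') (hbb' : b ≠ b') (hab : a ≠ b) (ha'b : a' ≠ b) (hab' : a ≠ b') (ha'b' : a' ≠ b')
    (ha : ∀ c', c' ≠ c → P a' c' = P a c') (hb : ∀ c', c' ≠ c → P b' c' = P b c') :
    (Matrix.of fun S S' : Row n => segE P S.1 (col S')).det = 0 := by
  classical
  -- the four distinct rows
  set r₁ : Row n := ⟨{a, b}, by rw [Finset.card_pair hab]⟩ with hr₁
  set r₂ : Row n := ⟨{a', b}, by rw [Finset.card_pair ha'b]⟩ with hr₂
  set r₃ : Row n := ⟨{a, b'}, by rw [Finset.card_pair hab']⟩ with hr₃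
  set r₄ : Row n := ⟨{a', b'}, by rw [Finset.card_pair ha'b']⟩ with hr₄
  have h12 : r₁ ≠ r₂ := by
    intro e
    have e' : ({a, b} : Finset (Fin n)) = {a', b} := congrArg Subtype.val e
    have : a ∈ ({a', b} : Finset (Fin n)) := e' ▸ Finset.mem_insert_self a {b}
    rcases Finset.mem_insert.mp this with h | h
    · exact haa' h
    · exact hab (Finset.mem_singleton.mp h)
  have h13 : r₁ ≠ r₃ := by
    intro e
    have e' : ({a, b} : Finset (Fin n)) = {a, b'} := congrArg Subtype.val e
    have : b ∈ ({a, b'} : Finset (Fin n)) := e' ▸ Finset.mem_insert_of_mem (Finset.mem_singleton_self b)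
    rcases Finset.mem_insert.mp this with h | h
    · exact hab h.symm
    · exact hbb' (Finset.mem_singleton.mp h)
  have h14 : r₁ ≠ r₄ := by
    intro e
    have e' : ({a, b} : Finset (Fin n)) = {a', b'} := congrArg Subtype.val e
    have : a ∈ ({a', b'} : Finset (Fin n)) := e' ▸ Finset.mem_insert_self a {b}
    rcases Finset.mem_insert.mp this with h | h
    · exact haa' h
    · exact hab' (Finset.mem_singleton.mp h)
  -- the kernel row vector
  set v : Row n → F := fun S => (if S = r₁ then 1 else 0) - (if S = r₂ then 1 else 0) - (if S = r₃ then 1 else 0) +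
    (if S = r₄ then 1 else 0) with hv
  apply Matrix.exists_vecMul_eq_zero_iff.mp
  refine ⟨v, ?_, ?_⟩
  · intro hv0
    have h1 : v r₁ = 0 := by rw [hv0, Pi.zero_apply]
    have h2 : v r₁ = 1 := by
      simp [hv, h12, h13, h14]
    exact one_ne_zero (h2 ▸ h1)
  · funext S'
    rw [Matrix.vecMul, Pi.zero_apply, dotProduct]
    simp only [hv, Matrix.of_apply, sub_mul, add_mul, ite_mul, one_mul, zero_mul, Finset.sum_add_distrib, Finset.sum_sub_distrib,
      Finset.sum_ite_eq', Finset.mem_univ, if_true]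
    exact segE_parallelogram P c hab ha'b hab' ha'b' ha hb (col S')

end NoGo

end Summit.ValiantsHypothesis.ValiantsHypothesis.Theorems.BarrierLever.ChowBenchmarkPeel
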